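import Summits.BirchSwinnertonDyer.Rank1Residual.AdditivePotMult.RankOneHeegnerAnyPrime
import Summits.BirchSwinnertonDyer.Rank1Residual.AdditivePotMult.OneSided
import Literature.NumberTheory.EllipticCurves.BSDQuadraticDescentShaOddPartGeneralProofs
import Literature.NumberTheory.EllipticCurves.Rank1Residual.Typed.JointLower
import HarnessLib

/-!
# ROUTE r3 (anticyclotomic / Heegner line at an additive prime): the JOINT lower half over a
# quadratic pair `(E, E^{d_K})`, its two missing inputs, and the bridge to the over-`K` currency
# (cell `b2b-bsdres`, team n1011; §1 is seat r3's folder sketch `SketchB.lean`, verbatim, landed by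
# seat p10 on seat p01's decision of 2026-08-21T05:58Z (lead ruling R3-13 (a), item R3-T1); §2 by p10)

HONEST FRAMING (cell `b2b-bsdres`, run/shared/lean/b2b/bsd-rank1-residual/, verbatim in every
file): the goal of the cell is to DELETE the COMBINATION-SHAPED residual classes of the
Birch–Swinnerton-Dyer formula for ALL analytic-rank `≤ 1` elliptic curves over `ℚ` — "full BSD
formula for every rank `≤ 1` curve in class `C`" assembled STRICTLY from published theorems — so
that the rank-`≤ 1` remainder becomes exactly the CONSTRUCTION-SHAPED classes, which are TYPED
(missing-input `Prop`s), NOT attempted. This is not "finishing BSD". Team n1011 (N10/N11/O7):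
research route; N10/N11/O7 stay CONSTRUCTION; nothing booked; no label moves; no Literature fact.
TWO `@[conjecture] def`s (`DefiniteInputAt`, `HeegnerInputAt` = MISSING INPUTS, construction-shaped,
NOT in print at `p² ∣ N` — ROUTE-r3.md §2; OUR typed inputs, nothing asserted) and theorems; the
bookkeeping predicate `JointLowerBoundAt` and its four lemmas (also r3's) are tree vocabulary:
`Literature/…/Rank1Residual/Typed/JointLower.lean`.

## §1 (seat r3) The joint currency and the two missing inputs

The anticyclotomic / Heegner line's output currency is a JOINT lower half over a quadratic pair
`(W, Wd)` (`Wd` a model of `W^{d_K}`): `ord_p #Ш(W)_an + ord_p #Ш(Wd)_an ≤ ord_p #Ш(W) + ord_p #Ш(Wd)`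
— every theorem "over `K`" (Gross–Zagier, Kolyvagin, anticyclotomic main conjectures at the
trivial character) pays out in it, since `L(E/K,s) = L(E,s)·L(E^{d_K},s)` and
`Ш(E/K)[p^∞] ≅ Ш(E)[p^∞] ⊕ Ш(E^{d_K})[p^∞]` for odd `p`. One kernel lemma turns "joint lower + UPPER
half of the partner" into `MissingLowerBoundAt` (`Typed.missingLowerBoundAt_of_joint_of_upper`); the two
`…InputAt` conjectures are what a printed "⊇"-divisibility of an anticyclotomic main conjecture at an
additive (nearly-ordinary) prime WOULD give at the trivial character, in Miller's currency, in the
definite (`r_an = 0`) and the Heegner (`r_an = 1`) setting; the reductions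
`missingLowerBoundAt_rankZero_of_definiteInput` / `missingLowerBoundAt_rankOne_of_heegnerInput` show
that on O7 rows the route's open inputs are ALL of lower type, exactly as on N10/N11.

## §2 (seat p10) Bridge to additive-p1's over-`K` currency (seat p01's request)

* `padicValNat_shaOrder_eq_add_of_odd` — `v_p #Ш(W'/K) = v_p #Ш(W) + v_p #Ш(Wd)` at ODD `p` in ANY
  rank, all three `Ш` finite (`card_primaryComponent_sha_baseChange_quadratic_of_odd_of_finite`,
  Jetchev–Skinner–Wan 2017 §7.4.1 / Dokchitser–Dokchitser 2010 Lemma 4.14; the tree's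
  `padicValNat_shaOrder_baseChange_quadratic_of_odd` wants `W'(K)` finite, i.e. rank `0` over `K`,
  which a Heegner pair never is).
* `lowerOver_of_jointLowerBoundAt` / `jointLowerBoundAt_of_lowerOver` /
  `jointLowerBoundAt_iff_lowerOver` — under the hypotheses of additive-p1's identity (★)
  `AdditivePotMult.shaAnOver_mul_eq` (`#Ш_an(W')·#Ш(W)·#Ш(Wd) = #Ш_an(W)·#Ш_an(Wd)·#Ш(W')`: modularity
  `hmod`, `[K:ℚ] = 2`, the twist / base-change models, `ShaFinite` ×3, Milne's Weil-restriction
  identity `hWR`) and `p ≠ 2`: `JointLowerBoundAt W Wd p ⟹ MissingLowerBoundOverAt W' p`, and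
  conversely GIVEN a rational value of `#Ш_an(Wd)` (the joint predicate wants the two rationals
  separately; (★) only returns their product). NO `BSDp Wd p` is needed — that is the point of the
  joint currency versus `AdditivePotMult.missingLowerBoundAt_iff_over`.

A Kolyvagin DERIVED certificate (McCallum 1991 Thm. 5.4/5.8, `Literature…KolyvaginShaStructure`)
already gives `BSDp` for BOTH members of the pair (`Additive.bsdp_of_derivedCertificate`,
`Additive.bsdp_twist_of_derivedCertificate`), hence the joint half by `joint_of_lower_of_lower`; no
separate name is given to that composition.
-/

noncomputable section

open scoped Classical NumberField

open WeierstrassCurve NumberField Literature.NumberTheory.EllipticCurves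
  Literature.NumberTheory.EllipticCurves.ModularForms
  Literature.NumberTheory.EllipticCurves.Rank1Residual
  Literature.NumberTheory.EllipticCurves.Rank1Residual.Typed
  Literature.NumberTheory.Automorphic

namespace Summit.BirchSwinnertonDyer.Rank1Residual.Additive.Route3Anticyc

/-! ## §1 The two missing inputs and the reductions (seat r3, `SketchB.lean`) -/

/-- MISSING INPUT (OUR conjecture-shaped typed input; NOT in print at `p² ∣ N`; nothing asserted),
rank ZERO provenance ("definite" anticyclotomic setting): for `W` of analytic rank `0` and an
imaginary quadratic `K` in which `p` splits whose twist `W^{d_K}` also has analytic rank `0`, the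
joint lower half over `(W, W^{d_K})`. What WOULD discharge it in print: the "⊇" (Skinner–Urban
direction) of the Bertolini–Darmon anticyclotomic main conjecture for `(E, K)` at the trivial
character + Gross/Waldspurger's special-value formula + the period comparison `Ω_{E/K}` vs
`Ω_E Ω_{E^K}` — in print ONLY for `p ∤ N` (`p`-ordinary). OPEN at `p² ∣ N` (ROUTE-r3.md §2). -/
@[conjecture] def DefiniteInputAt (W : WeierstrassCurve ℚ) [W.IsElliptic] (p : ℕ) : Prop :=
  ∀ (K : Type) [Field K] [NumberField K] (Wd : WeierstrassCurve ℚ) [Wd.IsElliptic]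
    [Wd.IsGloballyMinimal], IsImaginaryQuadratic K → SatisfiesHeegnerHypothesis p K →
    (∃ C : VariableChange ℚ, C • W.quadraticTwist (NumberField.discr K : ℚ) = Wd) →
    W.analyticRank = 0 → Wd.analyticRank = 0 → JointLowerBoundAt W Wd p

/-- MISSING INPUT (OUR conjecture-shaped typed input; NOT in print at `p² ∣ N`; nothing asserted),
rank ONE provenance ("indefinite" / Heegner setting): for `W` of analytic rank `1`, `K` Heegner
for `N_W` with `p` split, twist of analytic rank `0`, the joint lower half over `(W, W^{d_K})`.
What WOULD discharge it in print: the "⊇" of Perrin-Riou's Heegner-point main conjecture (the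
converse of the Howard / Fouquet–Disegni divisibility) at the trivial character + Gross–Zagier — in
print ONLY for good ordinary `p` (X. Wan; Burungale–Castella–Kim). OPEN at `p² ∣ N`; at additive
potentially-good-ordinary `p ≥ 5` the OTHER divisibility IS in print (Disegni 2017 Thm. D with
Fouquet 2013) (ROUTE-r3.md §2). Per PAIR it is discharged by a Kolyvagin derived certificate
(`Additive.bsdp_of_derivedCertificate` + `Additive.bsdp_twist_of_derivedCertificate`). -/
@[conjecture] def HeegnerInputAt (W : WeierstrassCurve ℚ) [W.IsElliptic] (p : ℕ) : Prop :=
  ∀ (K : Type) [Field K] [NumberField K] (Wd : WeierstrassCurve ℚ) [Wd.IsElliptic]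
    [Wd.IsGloballyMinimal], IsImaginaryQuadratic K →
    SatisfiesHeegnerHypothesis (W.conductorNorm ℤ) K → SatisfiesHeegnerHypothesis p K →
    (∃ C : VariableChange ℚ, C • W.quadraticTwist (NumberField.discr K : ℚ) = Wd) →
    W.analyticRank = 1 → Wd.analyticRank = 0 → JointLowerBoundAt W Wd p

/-- r = 0 REDUCTION: the definite input + ONE imaginary quadratic `K` (p split) whose rank-zero
twist has its UPPER half (kernel: Kato at potentially good `p`, KN20 at (M)) ⟹ LOWER for `W`.
This is exactly the N10/N11 missing object `MissingLowerBoundAt W p` of additive-p4's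
`X4RankZero.bsdp_of_missingLowerBoundAt`. [folklore] -/
theorem missingLowerBoundAt_rankZero_of_definiteInput
    (W : WeierstrassCurve ℚ) [W.IsElliptic] (p : ℕ) (hIn : DefiniteInputAt W p)
    (hr : W.analyticRank = 0)
    (K : Type) [Field K] [NumberField K] (hK : IsImaginaryQuadratic K)
    (hHp : SatisfiesHeegnerHypothesis p K)
    (Wd : WeierstrassCurve ℚ) [Wd.IsElliptic] [Wd.IsGloballyMinimal]
    (hWd : ∃ C : VariableChange ℚ, C • W.quadraticTwist (NumberField.discr K : ℚ) = Wd)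
    (hrd : Wd.analyticRank = 0) (hUd : MissingUpperBoundAt Wd p) :
    MissingLowerBoundAt W p :=
  missingLowerBoundAt_of_joint_of_upper (hIn K Wd hK hHp hWd hr hrd) hUd

/-- r = 1 REDUCTION: the Heegner input + a Heegner field `K` (p split) whose rank-zero twist has
its UPPER half ⟹ LOWER for the rank-one `W`; together with the LOWER halves of the rank-zero
Heegner twists this feeds the kernel's `bsdp_of_rankOne_of_lower_of_lowerTwists` (p ≥ 5) /
`RankOneHeegnerOdd` (odd p) to give `BSD(W,p)` — so on O7 rows the route's open inputs are ALL
of lower type, exactly as on N10/N11. [folklore] -/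
theorem missingLowerBoundAt_rankOne_of_heegnerInput
    (W : WeierstrassCurve ℚ) [W.IsElliptic] (p : ℕ) (hIn : HeegnerInputAt W p)
    (hr : W.analyticRank = 1)
    (K : Type) [Field K] [NumberField K] (hK : IsImaginaryQuadratic K)
    (hHN : SatisfiesHeegnerHypothesis (W.conductorNorm ℤ) K)
    (hHp : SatisfiesHeegnerHypothesis p K)
    (Wd : WeierstrassCurve ℚ) [Wd.IsElliptic] [Wd.IsGloballyMinimal]
    (hWd : ∃ C : VariableChange ℚ, C • W.quadraticTwist (NumberField.discr K : ℚ) = Wd)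
    (hrd : Wd.analyticRank = 0) (hUd : MissingUpperBoundAt Wd p) :
    MissingLowerBoundAt W p :=
  missingLowerBoundAt_of_joint_of_upper (hIn K Wd hK hHN hHp hWd hr hrd) hUd

/-! ## §2 Bridge to the over-`K` currency `AdditivePotMult.MissingLowerBoundOverAt` (seat p10) -/

section OverK

variable (W : WeierstrassCurve ℚ) [W.IsElliptic] (p : ℕ) [Fact p.Prime]
  (K : Type) [Field K] [NumberField K]
  (Wd : WeierstrassCurve ℚ) [Wd.IsElliptic] (W' : WeierstrassCurve K) [W'.IsElliptic]

/-- **`v_p #Ш(W'/K) = v_p #Ш(W/ℚ) + v_p #Ш(Wd/ℚ)` at an odd prime, ANY rank** (`[K:ℚ] = 2`, `Wd` a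
`ℚ`-model of `W^{(d_K)}`, `W'` a `K`-model of `W_K`, all three `Ш` finite): the odd-primary
comparison `#Ш(W')[p^∞] = #Ш(W)[p^∞]·#Ш(Wd)[p^∞]`
(`card_primaryComponent_sha_baseChange_quadratic_of_odd_of_finite`) read through
`#A[p^∞] = p^{v_p #A}`. [cite: JetchevSkinnerWan2017, §7.4.1 (arXiv:1512.06894 p. 30)]
[cite: DokchitserDokchitserAnnals2010, Lemma 4.14 (proof) and §2.1 (proof of Thm. 8)] -/
theorem padicValNat_shaOrder_eq_add_of_odd (h2 : Module.finrank ℚ K = 2)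
    (hWd : ∃ C : VariableChange ℚ, C • W.quadraticTwist (NumberField.discr K : ℚ) = Wd)
    (hW' : ∃ C : VariableChange K, C • W.baseChange K = W')
    (hshaW : W.ShaFinite) (hshaD : Wd.ShaFinite) (hshaK : W'.ShaFinite) (hp : p ≠ 2) :
    padicValNat p W'.shaOrder = padicValNat p W.shaOrder + padicValNat p Wd.shaOrder := by
  haveI : Finite W.sha := hshaW
  haveI : Finite Wd.sha := hshaD
  haveI : Finite W'.sha := hshaK
  exact padicValNat_natCard_eq_add_of_primaryComponent p
    (card_primaryComponent_sha_baseChange_quadratic_of_odd_of_finite W K h2 Wd hWd W' hW' p hp)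

/-- **Joint lower over `ℚ` ⟹ lower half over `K`** (odd `p`; hypotheses of (★)
`AdditivePotMult.shaAnOver_mul_eq`: modularity, `[K:ℚ] = 2`, the two models, `Ш` finite ×3,
Milne's identity `hWR`). The rational value over `K` is `q·q_d·#Ш(W')/(#Ш(W)·#Ш(Wd))`
(`AdditivePotMult.exists_shaAnOver_eq_of_rat`), of valuation `ord_p q + ord_p q_d` by
`padicValNat_shaOrder_eq_add_of_odd`. No `BSDp Wd p` is used. [folklore] -/
theorem lowerOver_of_jointLowerBoundAt (hmod : hasEntireLFunction_rat)
    (h2 : Module.finrank ℚ K = 2)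
    (hWd : ∃ C : VariableChange ℚ, C • W.quadraticTwist (NumberField.discr K : ℚ) = Wd)
    (hW' : ∃ C : VariableChange K, C • W.baseChange K = W')
    (hshaW : W.ShaFinite) (hshaD : Wd.ShaFinite) (hshaK : W'.ShaFinite)
    (hWR : (W'.shaOrder : ℝ) * W'.regulator * W'.bsdPeriod * (W'.tamagawaProduct : ℝ) /
        (W'.torsionOrder : ℝ) ^ 2 = W.bsdRHS * Wd.bsdRHS)
    (hp : p ≠ 2) (hJ : JointLowerBoundAt W Wd p) :
    AdditivePotMult.MissingLowerBoundOverAt W' p := by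
  obtain ⟨q, qd, hq, hqd, hle⟩ := hJ
  have hq' := AdditivePotMult.exists_shaAnOver_eq_of_rat W K Wd W' hmod h2 hWd hW' hshaW hshaD
    hshaK hWR hq hqd
  refine ⟨_, hq', ?_⟩
  have hadd := padicValNat_shaOrder_eq_add_of_odd W p K Wd W' h2 hWd hW' hshaW hshaD hshaK hp
  have hsW : (W.shaOrder : ℚ) ≠ 0 := by exact_mod_cast (W.shaOrder_pos hshaW).ne'
  have hsD : (Wd.shaOrder : ℚ) ≠ 0 := by exact_mod_cast (Wd.shaOrder_pos hshaD).ne'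
  have hsK : (W'.shaOrder : ℚ) ≠ 0 := by exact_mod_cast (W'.shaOrder_pos hshaK).ne'
  have hq0 : q ≠ 0 := by
    intro h0; apply AdditivePotMult.shaAn_ne_zero W hmod; rw [hq, h0, Rat.cast_zero]
  have hqd0 : qd ≠ 0 := by
    intro h0; apply AdditivePotMult.shaAn_ne_zero Wd hmod; rw [hqd, h0, Rat.cast_zero]
  rw [padicValRat.div (mul_ne_zero (mul_ne_zero hq0 hqd0) hsK) (mul_ne_zero hsW hsD),
    padicValRat.mul (mul_ne_zero hq0 hqd0) hsK, padicValRat.mul hq0 hqd0, padicValRat.mul hsW hsD,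
    padicValRat.of_nat, padicValRat.of_nat, padicValRat.of_nat]
  have hadd' : (padicValNat p W'.shaOrder : ℤ) = padicValNat p W.shaOrder + padicValNat p Wd.shaOrder := by
    exact_mod_cast hadd
  linarith

/-- **Lower half over `K` + a rational value of `#Ш_an(Wd)` ⟹ joint lower over `ℚ`** (odd `p`;
hypotheses of (★)). The rational value of `#Ш_an(W)` is `q'·#Ш(W)·#Ш(Wd)/(q_d·#Ш(W'))`
(`AdditivePotMult.exists_shaAn_eq_of_over`). The rationality of `#Ш_an(Wd)` is an INPUT: (★) only
returns the product of the two analytic orders over `ℚ`. No `BSDp Wd p` is used. [folklore] -/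
theorem jointLowerBoundAt_of_lowerOver (hmod : hasEntireLFunction_rat)
    (h2 : Module.finrank ℚ K = 2)
    (hWd : ∃ C : VariableChange ℚ, C • W.quadraticTwist (NumberField.discr K : ℚ) = Wd)
    (hW' : ∃ C : VariableChange K, C • W.baseChange K = W')
    (hshaW : W.ShaFinite) (hshaD : Wd.ShaFinite) (hshaK : W'.ShaFinite)
    (hWR : (W'.shaOrder : ℝ) * W'.regulator * W'.bsdPeriod * (W'.tamagawaProduct : ℝ) /
        (W'.torsionOrder : ℝ) ^ 2 = W.bsdRHS * Wd.bsdRHS)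
    (hp : p ≠ 2) {qd : ℚ} (hqd : shaAn Wd = (qd : ℂ))
    (hL : AdditivePotMult.MissingLowerBoundOverAt W' p) : JointLowerBoundAt W Wd p := by
  obtain ⟨q', hq', hle⟩ := hL
  have hq := AdditivePotMult.exists_shaAn_eq_of_over W K Wd W' hmod h2 hWd hW' hshaW hshaD hshaK
    hWR hq' hqd
  refine ⟨_, qd, hq, hqd, ?_⟩
  have hadd := padicValNat_shaOrder_eq_add_of_odd W p K Wd W' h2 hWd hW' hshaW hshaD hshaK hp
  have hsW : (W.shaOrder : ℚ) ≠ 0 := by exact_mod_cast (W.shaOrder_pos hshaW).ne'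
  have hsD : (Wd.shaOrder : ℚ) ≠ 0 := by exact_mod_cast (Wd.shaOrder_pos hshaD).ne'
  have hsK : (W'.shaOrder : ℚ) ≠ 0 := by exact_mod_cast (W'.shaOrder_pos hshaK).ne'
  have hqd0 : qd ≠ 0 := by
    intro h0; apply AdditivePotMult.shaAn_ne_zero Wd hmod; rw [hqd, h0, Rat.cast_zero]
  have hq'0 : q' ≠ 0 := by
    intro h0
    have h := AdditivePotMult.shaAnOver_mul_eq W K Wd W' hmod h2 hWd hW' hshaW hshaD hshaK hWR
    rw [hq', h0, Rat.cast_zero, zero_mul, zero_mul] at h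
    exact mul_ne_zero (mul_ne_zero (AdditivePotMult.shaAn_ne_zero W hmod)
      (AdditivePotMult.shaAn_ne_zero Wd hmod)) (by exact_mod_cast (W'.shaOrder_pos hshaK).ne')
      h.symm
  rw [padicValRat.div (mul_ne_zero (mul_ne_zero hq'0 hsW) hsD) (mul_ne_zero hqd0 hsK),
    padicValRat.mul (mul_ne_zero hq'0 hsW) hsD, padicValRat.mul hq'0 hsW, padicValRat.mul hqd0 hsK,
    padicValRat.of_nat, padicValRat.of_nat, padicValRat.of_nat]
  have hadd' : (padicValNat p W'.shaOrder : ℤ) = padicValNat p W.shaOrder + padicValNat p Wd.shaOrder := by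
    exact_mod_cast hadd
  linarith

/-- **Joint lower over `ℚ` ⟺ lower half over `K`**, given a rational value of `#Ш_an(Wd)` (odd
`p`; hypotheses of (★)). [folklore] -/
theorem jointLowerBoundAt_iff_lowerOver (hmod : hasEntireLFunction_rat)
    (h2 : Module.finrank ℚ K = 2)
    (hWd : ∃ C : VariableChange ℚ, C • W.quadraticTwist (NumberField.discr K : ℚ) = Wd)
    (hW' : ∃ C : VariableChange K, C • W.baseChange K = W')
    (hshaW : W.ShaFinite) (hshaD : Wd.ShaFinite) (hshaK : W'.ShaFinite)
    (hWR : (W'.shaOrder : ℝ) * W'.regulator * W'.bsdPeriod * (W'.tamagawaProduct : ℝ) /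
        (W'.torsionOrder : ℝ) ^ 2 = W.bsdRHS * Wd.bsdRHS)
    (hp : p ≠ 2) {qd : ℚ} (hqd : shaAn Wd = (qd : ℂ)) :
    JointLowerBoundAt W Wd p ↔ AdditivePotMult.MissingLowerBoundOverAt W' p :=
  ⟨lowerOver_of_jointLowerBoundAt W p K Wd W' hmod h2 hWd hW' hshaW hshaD hshaK hWR hp,
    jointLowerBoundAt_of_lowerOver W p K Wd W' hmod h2 hWd hW' hshaW hshaD hshaK hWR hp hqd⟩

end OverK

end Summit.BirchSwinnertonDyer.Rank1Residual.Additive.Route3Anticyc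

end
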